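import Summits.ResolutionOfSingularities.ResolutionOfSingularities.Theorems.PurelyInseparableDim4JointForestFinitePlanKitMembers
import Summits.ResolutionOfSingularities.ResolutionOfSingularities.Theorems.PurelyInseparableDim4JointTwoChartComputations
import Summits.ResolutionOfSingularities.ResolutionOfSingularities.Theorems.PurelyInseparableDim4JointForestInstance
import HarnessLib

/-!
# Purely inseparable four-folds: a certificate with TWO SEPARATED 3-FOLD MEMBERS, written on the members kit (brick S3 (c) «joint
# point∘coordinate chains», part 33, cell `res-dim4-pi`)

[OURS · counted 0] (D-0157 DOOR 2; desk WORD #66 (4)(c), #74 (g), #99 (d); frame `PIDim4.TerminationImpliesOrderReduction`, S3 (c);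
host item stmt-ResolutionOfSingularities-16155, helper). Nothing here proves resolution of singularities in dimension ≥ 4 /
characteristic `p` — NOT here, not anywhere in this programme; ONE explicit hypersurface family is resolved.

`F = (x₁² − x₁)^p x₂ = x₁^{2p} x₂ − x₁^p x₂` over `K = K̄` of characteristic `p`. The closed order-`p` points of `z^p + F` are the two
DISJOINT 3-folds `{x₁ = 0}` and `{x₁ = 1}` (`roots_twoMembers`: `∂F/∂x₂ = (x₁² − x₁)^p`); both are Hironaka-permissible; after blowing
up either, its chart reads `(y₁^p ∓ 1)·y₂` — a unit times `y₂` near the exceptional hyperplane, no equimultiple pair (`…_dead₀/₁`).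
* **`exists_isMarkedResolution_inst₁₀`** — `(𝔸⁵_K, (z^p + (x₁² − x₁)^p x₂)·𝒪, [], p)` admits a marked resolution (BGMW Def. 3.1.3): the
  members kit (part 28b) with `mem = {(0, {x₁}), (e₁, {x₁})}`, empty plans, no leaves. UNCONDITIONAL, every `p`; the first certificate
  with two positive-dimensional members.

AI-produced formalisation, weaker than expert review. bears_on: LADDER-RESOLUTION:D157-DOOR2 (res-dim4-pi · S3 (c) joint v2 · two
members instance).
-/

set_option linter.dupNamespace false -- D-0017: single-problem summit path `Summit.<S>.<S>.…` by design

noncomputable section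

open MvPolynomial Finset CategoryTheory AlgebraicGeometry Opposite TopologicalSpace

namespace Summit.ResolutionOfSingularities.ResolutionOfSingularities.Theorems.PIDim4

open Literature.AlgebraicGeometry.Resolution
open Literature.AlgebraicGeometry.Resolution.Hauser2010
open Literature.AlgebraicGeometry.Resolution.AffinePointBlowup (P A γ coord Wtop ξ)

namespace Equimultiple

section Instance₁₀

variable {K : Type} [Field K] {p : ℕ} [hp : Fact p.Prime] [CharP K p]

/-! ## §1 Computations -/

omit hp [CharP K p] in
/-- `F` as a sum of two monomials. [folklore] -/
theorem twoMembers_eq_monomial_add :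
    (X 0 ^ (2 * p) * X 1 - X 0 ^ p * X 1 : MvPolynomial (Fin 4) K) =
      monomial (Finsupp.single 0 (2 * p) + Finsupp.single 1 1) 1 + monomial (Finsupp.single 0 p + Finsupp.single 1 1) (-1) := by
  have h1 : (X 0 ^ (2 * p) * X 1 : MvPolynomial (Fin 4) K) = monomial (Finsupp.single 0 (2 * p) + Finsupp.single 1 1) 1 := by
    rw [X_pow_eq_monomial, X, monomial_mul, mul_one]
  rw [h1, X_pow_mul_X_eq_monomial, map_neg, ← sub_eq_add_neg]

omit hp [CharP K p] in
/-- The support of `F`. [folklore] -/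
theorem mem_support_twoMembers {d : Fin 4 →₀ ℕ} (hd : d ∈ (X 0 ^ (2 * p) * X 1 - X 0 ^ p * X 1 : MvPolynomial (Fin 4) K).support) :
    d = Finsupp.single 0 (2 * p) + Finsupp.single 1 1 ∨ d = Finsupp.single 0 p + Finsupp.single 1 1 := by
  rw [twoMembers_eq_monomial_add] at hd
  rcases Finset.mem_union.mp (Finset.mem_of_subset MvPolynomial.support_add hd) with h | h
  · exact Or.inl (Finset.mem_singleton.mp (Finset.mem_of_subset support_monomial_subset h))
  · exact Or.inr (Finset.mem_singleton.mp (Finset.mem_of_subset support_monomial_subset h))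

omit [CharP K p] in
/-- `F` is clean (exponent `1` of `x₂`). [cite: HauserPerlega2019PRIMS, §2 (cleaning)] -/
theorem isClean_twoMembers :
    Literature.Barriers.ResolutionOfSingularities.HauserPerlega.IsClean p (X 0 ^ (2 * p) * X 1 - X 0 ^ p * X 1 : MvPolynomial (Fin 4) K) := by
  intro d hd hpth
  have key : d 1 = 1 → False := fun hi => by
    have h := hpth 1 (by rw [Finsupp.mem_support_iff, hi]; exact one_ne_zero)
    rw [hi] at h
    exact hp.out.one_lt.ne' (Nat.dvd_one.mp h)
  rcases mem_support_twoMembers hd with rfl | rfl <;> exact key (by simp)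

omit [CharP K p] in
/-- `F ≠ 0`. [folklore] -/
theorem twoMembers_ne_zero : (X 0 ^ (2 * p) * X 1 - X 0 ^ p * X 1 : MvPolynomial (Fin 4) K) ≠ 0 := by
  have hp0 : p ≠ 0 := hp.out.ne_zero
  intro h
  have hc := congrArg (coeff (Finsupp.single (0 : Fin 4) (2 * p) + Finsupp.single 1 1)) h
  have n2 : (Finsupp.single (0 : Fin 4) p + Finsupp.single 1 1) ≠ Finsupp.single 0 (2 * p) + Finsupp.single 1 1 := fun h' => by
    have := DFunLike.congr_fun h' 0; simp at this; omega
  rw [twoMembers_eq_monomial_add, coeff_add, coeff_monomial, if_pos rfl, coeff_monomial, if_neg n2, coeff_zero] at hc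
  simp at hc

/-- **The root parameters**: `b₁ = 0 ∨ b₁ = 1` (`∂F/∂x₂ = (x₁² − x₁)^p`). [cite: Hauser2010, §F (equiconstant points)] -/
theorem roots_twoMembers (b : Fin 4 → K)
    (H : ∀ d : Fin 4 →₀ ℕ, d ≠ 0 → d.degree < p → coeff d (PointBlowup.translate b
      (X 0 ^ (2 * p) * X 1 - X 0 ^ p * X 1 : MvPolynomial (Fin 4) K)) = 0) :
    b 0 = 0 ∨ b 0 = 1 := by
  have hp0 : p ≠ 0 := hp.out.ne_zero
  have h1 := eval_pderiv_eq_zero_of_forall_coeff b _ H 1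
  simp [(pderiv (1 : Fin 4)).leibniz_pow] at h1
  have hsq : (b 0 * b 0 - b 0) ^ p = 0 := by
    rw [sub_pow_char, mul_pow, ← pow_two, ← pow_mul, mul_comm p 2]
    exact h1
  have h' : b 0 * (b 0 - 1) = 0 := by rw [mul_sub, mul_one]; exact pow_eq_zero_iff hp0 |>.mp hsq
  rcases mul_eq_zero.mp h' with h | h
  · exact Or.inl h
  · exact Or.inr (sub_eq_zero.mp h)

/-- **`F(x + e₁) = x₁^{2p} x₂ + x₁^p x₂`** (the second member re-centred). [cite: Hauser2010, §F (translation)] -/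
theorem translate_e₀_twoMembers :
    PointBlowup.translate (Pi.single 0 1 : Fin 4 → K) (X 0 ^ (2 * p) * X 1 - X 0 ^ p * X 1 : MvPolynomial (Fin 4) K) =
      X 0 ^ (2 * p) * X 1 + X 0 ^ p * X 1 := by
  unfold PointBlowup.translate
  simp only [map_sub, map_mul, map_pow, aeval_X, Pi.single_eq_same, C_1,
    Pi.single_eq_of_ne (show (1 : Fin 4) ≠ 0 by decide), C_0, add_zero]
  have h1p : ((X 0 : MvPolynomial (Fin 4) K) + 1) ^ p = X 0 ^ p + 1 := by rw [add_pow_char, one_pow]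
  rw [mul_comm 2 p, pow_mul, pow_mul, h1p]
  ring

omit hp [CharP K p] in
/-- `F(x + e₁)` as a sum of two monomials. [folklore] -/
theorem twoMembers'_eq_monomial_add :
    (X 0 ^ (2 * p) * X 1 + X 0 ^ p * X 1 : MvPolynomial (Fin 4) K) =
      monomial (Finsupp.single 0 (2 * p) + Finsupp.single 1 1) 1 + monomial (Finsupp.single 0 p + Finsupp.single 1 1) 1 := by
  have h1 : (X 0 ^ (2 * p) * X 1 : MvPolynomial (Fin 4) K) = monomial (Finsupp.single 0 (2 * p) + Finsupp.single 1 1) 1 := by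
    rw [X_pow_eq_monomial, X, monomial_mul, mul_one]
  rw [h1, X_pow_mul_X_eq_monomial]

omit hp [CharP K p] in
/-- The support of `F(x + e₁)`. [folklore] -/
theorem mem_support_twoMembers' {d : Fin 4 →₀ ℕ} (hd : d ∈ (X 0 ^ (2 * p) * X 1 + X 0 ^ p * X 1 : MvPolynomial (Fin 4) K).support) :
    d = Finsupp.single 0 (2 * p) + Finsupp.single 1 1 ∨ d = Finsupp.single 0 p + Finsupp.single 1 1 := by
  rw [twoMembers'_eq_monomial_add] at hd
  rcases Finset.mem_union.mp (Finset.mem_of_subset MvPolynomial.support_add hd) with h | h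
  · exact Or.inl (Finset.mem_singleton.mp (Finset.mem_of_subset support_monomial_subset h))
  · exact Or.inr (Finset.mem_singleton.mp (Finset.mem_of_subset support_monomial_subset h))

omit [CharP K p] in
/-- `F(x + e₁)` is clean. [cite: HauserPerlega2019PRIMS, §2 (cleaning)] -/
theorem isClean_twoMembers' :
    Literature.Barriers.ResolutionOfSingularities.HauserPerlega.IsClean p (X 0 ^ (2 * p) * X 1 + X 0 ^ p * X 1 : MvPolynomial (Fin 4) K) := by
  intro d hd hpth
  have key : d 1 = 1 → False := fun hi => by
    have h := hpth 1 (by rw [Finsupp.mem_support_iff, hi]; exact one_ne_zero)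
    rw [hi] at h
    exact hp.out.one_lt.ne' (Nat.dvd_one.mp h)
  rcases mem_support_twoMembers' hd with rfl | rfl <;> exact key (by simp)

omit hp [CharP K p] in
/-- **Both members are Hironaka-permissible** (`x₁`-degree `≥ p` throughout). [cite: HauserPerlega2019PRIMS, §2 (condition (1))] -/
theorem isPermissibleCentre_twoMembers :
    IsPermissibleCentre p ({0} : Finset (Fin 4)) (X 0 ^ (2 * p) * X 1 - X 0 ^ p * X 1 : MvPolynomial (Fin 4) K) ∧
    IsPermissibleCentre p ({0} : Finset (Fin 4)) (X 0 ^ (2 * p) * X 1 + X 0 ^ p * X 1 : MvPolynomial (Fin 4) K) := by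
  refine ⟨⟨⟨0, Finset.mem_singleton_self _⟩, Finset.le_inf fun d hd => ?_⟩, ⟨⟨0, Finset.mem_singleton_self _⟩, Finset.le_inf fun d hd => ?_⟩⟩
  · rcases mem_support_twoMembers hd with rfl | rfl <;> simp [degIn_singleton_zero]
    exact_mod_cast (by omega)
  · rcases mem_support_twoMembers' hd with rfl | rfl <;> simp [degIn_singleton_zero]
    exact_mod_cast (by omega)

omit hp [CharP K p] in
/-- **The `x₁`-charts**: `(y₁^p − 1)·y₂` over the first member, `(y₁^p + 1)·y₂` over the second. [cite: HauserPerlega2019PRIMS, §2] -/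
theorem chartTransform_twoMembers :
    CentreBlowup.chartTransform p ({0} : Finset (Fin 4)) 0 (X 0 ^ (2 * p) * X 1 - X 0 ^ p * X 1 : MvPolynomial (Fin 4) K) =
      X 0 ^ p * X 1 - X 1 ∧
    CentreBlowup.chartTransform p ({0} : Finset (Fin 4)) 0 (X 0 ^ (2 * p) * X 1 + X 0 ^ p * X 1 : MvPolynomial (Fin 4) K) =
      X 0 ^ p * X 1 + X 1 := by
  have e1 : (Finsupp.single 0 (2 * p) + Finsupp.single 1 1 : Fin 4 →₀ ℕ).update 0
      ((Finsupp.single 0 (2 * p) + Finsupp.single 1 1 : Fin 4 →₀ ℕ) 0 - p) = Finsupp.single 0 p + Finsupp.single 1 1 := by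
    ext i; fin_cases i <;> simp [Finsupp.update_apply]; omega
  have e2 : (Finsupp.single 0 p + Finsupp.single 1 1 : Fin 4 →₀ ℕ).update 0
      ((Finsupp.single 0 p + Finsupp.single 1 1 : Fin 4 →₀ ℕ) 0 - p) = Finsupp.single 1 1 := by
    ext i; fin_cases i <;> simp [Finsupp.update_apply]
  constructor
  · rw [twoMembers_eq_monomial_add, CentreBlowup.chartTransform_monomial_add_monomial]
    simp only [CentreBlowup.chartExponent, degIn_singleton_zero]
    rw [e1, e2, ← X_pow_mul_X_eq_monomial, map_neg, ← sub_eq_add_neg]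
    rfl
  · rw [twoMembers'_eq_monomial_add, CentreBlowup.chartTransform_monomial_add_monomial]
    simp only [CentreBlowup.chartExponent, degIn_singleton_zero]
    rw [e1, e2, ← X_pow_mul_X_eq_monomial]
    rfl

omit hp [CharP K p] in
/-- **Over the first member nothing is equimultiple**: the linear coefficient of `y₂` is `b₁^p − 1 = −1`.
[cite: Hauser2010, §F (equiconstant points)] -/
theorem not_isEquimultiplePoint_twoMembers₀ [Fact p.Prime] [DecidableEq K] (b : Fin 4 → K) (hb0 : b 0 = 0) (s : State K)
    (hs : s.F = X 0 ^ (2 * p) * X 1 - X 0 ^ p * X 1) :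
    ¬ CentreBlowup.IsEquimultiplePoint p ({0} : Finset (Fin 4)) 0 b s := by
  have hp0 : p ≠ 0 := (Fact.out : p.Prime).ne_zero
  intro h
  unfold CentreBlowup.IsEquimultiplePoint CentreBlowup.pointTransform at h
  rw [hs, chartTransform_twoMembers.1] at h
  have h1 := h (Finsupp.single 1 1) (Finsupp.single_ne_zero.mpr one_ne_zero)
    (by rw [Finsupp.degree_single]; exact (Fact.out : p.Prime).one_lt)
  rw [coeff_single_one_translate] at h1
  simp [(pderiv (1 : Fin 4)).leibniz_pow, hb0, zero_pow hp0] at h1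

omit hp [CharP K p] in
/-- **Over the second member nothing is equimultiple**: the linear coefficient of `y₂` is `b₁^p + 1 = 1`.
[cite: Hauser2010, §F (equiconstant points)] -/
theorem not_isEquimultiplePoint_twoMembers₁ [Fact p.Prime] [DecidableEq K] (b : Fin 4 → K) (hb0 : b 0 = 0) (s : State K)
    (hs : s.F = X 0 ^ (2 * p) * X 1 + X 0 ^ p * X 1) :
    ¬ CentreBlowup.IsEquimultiplePoint p ({0} : Finset (Fin 4)) 0 b s := by
  have hp0 : p ≠ 0 := (Fact.out : p.Prime).ne_zero
  intro h
  unfold CentreBlowup.IsEquimultiplePoint CentreBlowup.pointTransform at h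
  rw [hs, chartTransform_twoMembers.2] at h
  have h1 := h (Finsupp.single 1 1) (Finsupp.single_ne_zero.mpr one_ne_zero)
    (by rw [Finsupp.degree_single]; exact (Fact.out : p.Prime).one_lt)
  rw [coeff_single_one_translate] at h1
  simp [(pderiv (1 : Fin 4)).leibniz_pow, hb0, zero_pow hp0] at h1

/-! ## §2 The certificate -/

/-- **`z^p + (x₁² − x₁)^p x₂` ADMITS A MARKED RESOLUTION** (`K = K̄` of characteristic `p`): blow up the two disjoint 3-folds
`V(z, x₁)` and `V(z, x₁ − 1)` (glued); nothing of order `p` survives. [cite: BierstoneGrigorievMilmanWlodarczyk2011, Def. 3.1.3]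
[cite: HauserPerlega2019PRIMS, §2] [cite: Hauser2010, §F (equiconstant points)] -/
theorem exists_isMarkedResolution_inst₁₀ [IsAlgClosed K] [DecidableEq K] :
    ∃ (X' : Scheme.{0}) (ρ : X' ⟶ P 4 K) (M' : MarkedIdeal X'),
      IsMarkedResolution (⟨hypSheaf p (X 0 ^ (2 * p) * X 1 - X 0 ^ p * X 1 : MvPolynomial (Fin 4) K), [], p⟩ :
        MarkedIdeal (P 4 K)) ρ M' := by
  classical
  have hs₁ : deletePthPowers p (PointBlowup.translate (0 : Fin 4 → K) (X 0 ^ (2 * p) * X 1 - X 0 ^ p * X 1 : MvPolynomial (Fin 4) K)) =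
      X 0 ^ (2 * p) * X 1 - X 0 ^ p * X 1 := by
    rw [PointBlowup.translate_zero]
    exact Literature.Barriers.ResolutionOfSingularities.HauserPerlega.deletePthPowers_eq_self isClean_twoMembers
  have hs₂ : deletePthPowers p (PointBlowup.translate (Pi.single 0 1 : Fin 4 → K)
      (X 0 ^ (2 * p) * X 1 - X 0 ^ p * X 1 : MvPolynomial (Fin 4) K)) = X 0 ^ (2 * p) * X 1 + X 0 ^ p * X 1 := by
    rw [translate_e₀_twoMembers]
    exact Literature.Barriers.ResolutionOfSingularities.HauserPerlega.deletePthPowers_eq_self isClean_twoMembers'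
  have hne : ((0 : Fin 4 → K), ({0} : Finset (Fin 4))) ≠ ((Pi.single 0 1 : Fin 4 → K), ({0} : Finset (Fin 4))) := fun h => by
    have := congrFun (congrArg Prod.fst h) 0
    simp at this
  -- the rules: nothing planned, no leaves
  let plan : State K → Finset (Fin 4) → Finset (Fin 4 × (Fin 4 → K) × Finset (Fin 4)) := fun _ _ => ∅
  let leaves : State K → Finset (Fin 4) → Finset (Fin 4 × (Fin 4 → K)) := fun _ _ => ∅
  refine exists_isMarkedResolution_finite_plan_cert_members (p := p) (X 0 ^ (2 * p) * X 1 - X 0 ^ p * X 1) twoMembers_ne_zero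
    isClean_twoMembers {((0 : Fin 4 → K), ({0} : Finset (Fin 4))), ((Pi.single 0 1 : Fin 4 → K), ({0} : Finset (Fin 4)))}
    (fun bS hbS => ?_) (fun bS hbS bS' hbS' hne' => ?_) (fun b' H => ?_) plan leaves
    {((⟨X 0 ^ (2 * p) * X 1 - X 0 ^ p * X 1, 0, ∅⟩ : State K), ({0} : Finset (Fin 4))),
      ((⟨X 0 ^ (2 * p) * X 1 + X 0 ^ p * X 1, 0, ∅⟩ : State K), ({0} : Finset (Fin 4)))}
    (fun bS hbS => ?_) (fun q _ e he => absurd he (Finset.notMem_empty e)) (fun _ => 0)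
    (fun q _ e he => absurd he (Finset.notMem_empty e)) (fun q _ e he => absurd he (Finset.notMem_empty e))
    (fun q _ e he => absurd he (Finset.notMem_empty e)) (fun q _ l hl => absurd hl (Finset.notMem_empty l))
    (fun q hq j' b' hj' hb' _ heq => ?_)
  · -- both members permissible
    rcases Finset.mem_insert.mp hbS with rfl | hbS
    · rw [hs₁]; exact isPermissibleCentre_twoMembers.1
    · rw [Finset.mem_singleton] at hbS; subst hbS
      rw [hs₂]; exact isPermissibleCentre_twoMembers.2
  · -- separated: `x₁ = 0` versus `x₁ = 1`
    refine ⟨0, ?_, ?_, ?_⟩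
    · rcases Finset.mem_insert.mp hbS with rfl | hbS
      · exact Finset.mem_singleton_self _
      · rw [Finset.mem_singleton] at hbS; subst hbS; exact Finset.mem_singleton_self _
    · rcases Finset.mem_insert.mp hbS' with rfl | hbS'
      · exact Finset.mem_singleton_self _
      · rw [Finset.mem_singleton] at hbS'; subst hbS'; exact Finset.mem_singleton_self _
    · rcases Finset.mem_insert.mp hbS with rfl | hbS <;> rcases Finset.mem_insert.mp hbS' with rfl | hbS'
      · exact absurd rfl hne'
      · rw [Finset.mem_singleton] at hbS'; subst hbS'; simp
      · rw [Finset.mem_singleton] at hbS; subst hbS; simp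
      · rw [Finset.mem_singleton] at hbS hbS'; subst hbS; subst hbS'; exact absurd rfl hne'
  · -- every root parameter lies on a member
    rcases roots_twoMembers b' H with h | h
    · exact ⟨_, Finset.mem_insert_self _ _, fun i hi => by rw [Finset.mem_singleton] at hi; subst hi; simpa using h⟩
    · exact ⟨_, Finset.mem_insert_of_mem (Finset.mem_singleton_self _), fun i hi => by
        rw [Finset.mem_singleton] at hi; subst hi; simpa using h⟩
  · -- the members' root pairs lie in `Q`
    rcases Finset.mem_insert.mp hbS with rfl | hbS
    · rw [hs₁]; exact Finset.mem_insert_self _ _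
    · rw [Finset.mem_singleton] at hbS; subst hbS
      rw [hs₂]; exact Finset.mem_insert_of_mem (Finset.mem_singleton_self _)
  · -- normalised cover: nothing is equimultiple over either member
    exfalso
    rcases Finset.mem_insert.mp hq with rfl | hq
    · rw [Finset.mem_singleton] at hj'; subst hj'
      exact not_isEquimultiplePoint_twoMembers₀ b' hb' _ rfl heq
    · rw [Finset.mem_singleton] at hq; subst hq
      rw [Finset.mem_singleton] at hj'; subst hj'
      exact not_isEquimultiplePoint_twoMembers₁ b' hb' _ rfl heq

end Instance₁₀

end Equimultiple

end Summit.ResolutionOfSingularities.ResolutionOfSingularities.Theorems.PIDim4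

end
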